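import Summits.ValiantsHypothesis.ValiantsHypothesis.Theorems.BarrierLeverAnchoredDoorHitsLowerPairsBlockPairing

/-!
# Support item `AnchoredDoorHitsLowerPairs` (stmt-ValiantsHypothesis-22510), line `anchored-peeling`:
# BLOCK PAIRING WITH KERNEL BASES — module M2 of the UQ_s-step for a general gap `m`

Helper file (`--supports stmt-ValiantsHypothesis-22510`; cell valiant-natproofs, rung V4, 𝒟-side door (c); registered line
`Cruxes/AnchoredDoorHitsLowerPairs/Lines/anchored_peeling.lean` v13; prover seat val-np-p1 gen 19; blueprint HOME/val-np-p1/g19/QSTEP-BLUEPRINT). Pure linear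
algebra over an integral domain. Closes NO item.

The rank-one case (`…KernelLine`, gap `m = 1`) collapses the block-pairing hypothesis to one ring element. For a general gap `m` the left kernel of the tall
block and the right kernel of the wide block are `m`-dimensional; given SPANNING families `ν₁..ν_m` and `β₁..β_m` (spanning up to a nonzero scalar, as
cofactor bases over a domain do), the hypothesis collapses to the non-vanishing of ONE `m × m` determinant, the CROSS MATRIX `P k l = ν_k ⬝ᵥ S *ᵥ β_l`.

* `det_ne_zero_of_blockPairing_basis` — zero block, independent `p`-rows, a family `ν` (supported off `p`, killing the `q`-columns) such that every such `x`
  satisfies `μ • x = Σ c_k • ν_k` for some `μ ≠ 0`, a family `β` (supported off `q`, `(S *ᵥ β_l)|_p = 0`), and `det P ≠ 0` ⟹ `det S ≠ 0`.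

WHAT THIS IS NOT: the cofactor bases themselves (the `m`-row generalisation of `…KernelLineBlocks`) and the private-monomial computation of `det P` (M3) are
separate files; nothing on crux stmt-ValiantsHypothesis-14610 or on `VP` versus `VNP`.
-/

set_option linter.dupNamespace false

open Matrix

namespace Summit.ValiantsHypothesis.ValiantsHypothesis.Theorems.BarrierLever.AnchoredPeeling

section Basis

variable {A : Type*} [CommRing A] [IsDomain A] {m : Type*} [Fintype m] [DecidableEq m] {κ : Type*} [Fintype κ] [DecidableEq κ]

/-- **Block pairing with kernel bases.** See the module docstring. -/
theorem det_ne_zero_of_blockPairing_basis (S : Matrix m m A) (p q : m → Prop) [DecidablePred p] [DecidablePred q]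
    (hzero : ∀ i j, p i → q j → S i j = 0)
    (hE : ∀ z : m → A, (∀ i, ¬ p i → z i = 0) → z ᵥ* S = 0 → z = 0)
    (ν : κ → m → A)
    (hspan : ∀ x : m → A, (∀ i, p i → x i = 0) → (∀ j, q j → (x ᵥ* S) j = 0) →
      ∃ μ : A, μ ≠ 0 ∧ ∃ c : κ → A, μ • x = ∑ k, c k • ν k)
    (β : κ → m → A) (hβq : ∀ l j, q j → β l j = 0) (hβp : ∀ l i, p i → (S *ᵥ β l) i = 0)
    (hP : (Matrix.of fun k l : κ => ν k ⬝ᵥ (S *ᵥ β l)).det ≠ 0) :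
    S.det ≠ 0 := by
  classical
  refine det_ne_zero_of_blockPairing S p q hzero hE (fun x hxp hxq hx0 => ?_)
  obtain ⟨μ, hμ, c, hc⟩ := hspan x hxp hxq
  -- c ≠ 0
  have hc0 : c ≠ 0 := by
    intro h0
    rw [h0] at hc
    simp only [Pi.zero_apply, zero_smul, Finset.sum_const_zero] at hc
    exact hx0 ((smul_eq_zero.mp hc).resolve_left hμ)
  -- c ᵥ* P ≠ 0
  set P : Matrix κ κ A := Matrix.of fun k l : κ => ν k ⬝ᵥ (S *ᵥ β l) with hPdef
  have hcP : c ᵥ* P ≠ 0 := fun h0 => hc0 (Matrix.eq_zero_of_vecMul_eq_zero hP h0)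
  obtain ⟨l, hl⟩ : ∃ l, (c ᵥ* P) l ≠ 0 := by
    by_contra hno
    exact hcP (funext fun l => not_not.mp (not_exists.mp hno l))
  refine ⟨β l, hβq l, hβp l, fun hx => hl ?_⟩
  -- μ • (x ⬝ S β_l) = (Σ c_k ν_k) ⬝ S β_l = (c ᵥ* P) l
  have key : μ * (x ⬝ᵥ (S *ᵥ β l)) = (c ᵥ* P) l := by
    rw [← smul_eq_mul, ← smul_dotProduct, hc]
    change (∑ k, c k • ν k) ⬝ᵥ (S *ᵥ β l) = ∑ k, c k * P k l
    rw [sum_dotProduct]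
    refine Finset.sum_congr rfl (fun k _ => ?_)
    rw [smul_dotProduct, smul_eq_mul, hPdef, Matrix.of_apply]
  rw [← key, hx, mul_zero]

end Basis

end Summit.ValiantsHypothesis.ValiantsHypothesis.Theorems.BarrierLever.AnchoredPeeling
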